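import Literature.MathematicalPhysics.QuantumFieldTheory.Balaban1983to89.B16Ineq382TreeGauge

/-!
# `Balaban1983to89.B15TreeGauge196Rethreshold` — T. Bałaban, *Large field renormalization. I. The basic step of the 𝐑 operation*, Commun. Math. Phys. **122** (1989) 175–202 [Balaban1989LargeFieldI], p. 196, the tree gauge of the annulus `P₁ ∖ P₂` with TWO admissible thresholds *"a number a ∈ (a′₁, b′₁)"*: the contour `Γ^a_{y,x}` of one threshold, measured in the tree gauge of another threshold `a′`, deviates from `1` by at most `5W²ε` — PROVED (the rectangle of [Balaban1989LargeFieldII] p. 382, flat or moved off `P₂`; seat p26, Phase-2 continuation of row **B15.Claim@196**)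

statement-level skeleton of published theorems with citation tags; proofs where landed; nothing here is a claim about the Yang–Mills mass gap

PDF held: `paper:balaban1989-cmp122-large-field-i` (journal page = PDF page + 174; p. 196 = PDF p. 22, text layer re-read by this
seat 2026-08-21); [Balaban1989LargeFieldII] pp. 381–382 = PDF pp. 27–28 of `paper:balaban1989-cmp122-large-field-ii`.

WHAT IS REPRODUCED (mega-formalization `lit-balaban`, HOME `run/shared/lean/pub/lit-balaban/`, Phase-2 seat p26, generation 7;
SKELETON rows **B15.Def@196** (r12) / **B15.Claim@196**).  P. 196, verbatim: *"We fix the initial point y = (a₁ + 1/2, …, a_d + 1/2),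
and a number a ∈ (a′₁, b′₁). For a given point x of the lattice in P₁∖P₂ we choose a contour connecting x to y. If x₁ ≦ a, then
we take the usual contour … If x₁ > a, then we take the contour [through the far face x₁ = b₁ − 1/2]"* — the threshold `a` is
chosen PER PAIR `(P₁, P₂)` of the chain `Λ ⊃ Z″_k ⊃ ⋯`; the landed single-scale model of the whole tree `T₀` (`B15TreeGaugeT0`,
`B15Claim196T0`, generation 5) used ONE common threshold for all pairs (reading choice (a) of HOME/GAPS.md G-B15-p26-03).  This
file supplies the one estimate needed to pass between two admissible thresholds `a, a′` of the SAME pair: for a `U1`-valued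
bond field `V` on the annulus in the tree gauge of threshold `a′` (`Case1Hyp … τ′ …`: `V(Γ^{a′}_{y,x}) = 1`, plaquettes with
corners in `P₁∖P₂` `ε`-close to `1`, sides of `P₁` of `≤ W + 1` sites), **`norm_hol_contour_rethreshold_le`**: `‖V(Γ^{a}_{y,x}) −
1‖ ≤ 5W²ε` for every `x ∈ P₁∖P₂` and every other admissible `a` (`Geom … τ`).  Equivalently (gauge-free form,
**`norm_hol_contour_ratio_le`**): `‖U(Γ^{a}_{y,x})·U(Γ^{a′}_{y,x})⁻¹ − 1‖ ≤ 5W²ε` for any `U1`-valued `U` with `ε`-small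
plaquettes on the annulus.  THE PROOF: the two contours agree unless `x₁` lies between the thresholds, and then (after the
common high part) they are the usual `[2-segment][1-segment]` and the detour `[1-segment to b₁ − 1/2][2-segment][1-segment
back]`, whose ratio is the boundary of the RECTANGLE `[y₁, b₁ − 1/2] × [y₂, x₂]` in the `(1,2)`-plane at `(x₃, …, x_d)` —
literally the rectangle of generation 2's `B16Ineq382.case_mixed` ([V] p. 382 case 1) without its extra bond: a flat `≤ W²ε`
Stokes bound when the rectangle misses `P₂` (**`rect_bound`**, flat branch), otherwise (`x₂ > b′₂`, `P₂` inside the rectangle's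
plane region) the rectangle is moved in direction `3` to the face `x₃ = y₃` of `P₁` (cylinder of `≤ 4W²` plaquettes avoiding
`P₂`, `norm_hol_shift_sub_one_le`) and spanned there: `≤ 5W²ε`.  `d ≥ 3` is needed (as in generation 2).

HONEST SCOPE.  Lattice combinatorics + the elementary Stokes estimates of `B16Ineq382Stokes`; one rectangular annulus of
`ℤ^{n+3}`, `U1 𝔸`-valued fields (`⊇ U(N)`), `≤ ε` plaquette hypotheses; nothing of [IV]/[V] is asserted beyond what is proved.
The print states no such lemma separately (it fixes the gauge and asserts the bound on `V′`); this is the step of OUR proof of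
the p. 196 claim that lets the thresholds vary from pair to pair (consumed by `B15Claim196T0Var`).  Unit `lit-balaban-p26`
(literature-prover-lit-balaban-p26-g7-0).
-/

noncomputable section

open scoped BigOperators

namespace Literature.MathematicalPhysics.QuantumFieldTheory.Balaban1983to89.B16Ineq382

open B7Prop1Explicit B8Lemma1NonAbelian B15TreeGauge196

variable {n : ℕ} {𝔸 : Type*} [NormedRing 𝔸] [NormOneClass 𝔸]
variable {lo hi lo' hi' : Site (n + 3)} {τ τ' : ℤ} {W : ℕ} {V : Site (n + 3) → Fin (n + 3) → 𝔸ˣ} {ε : ℝ}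

/-! ## §1 The loop of the two contours is a rectangle boundary (list algebra) -/

/-- The usual tail `[2-seg m] ∪ [1-seg n₀]` followed by the REVERSED detour tail `([1-seg N] ∪ [2-seg m] ∪ [1-seg −k])⁻¹`,
`N = n₀ + k`, is the rectangle boundary `wideLadder [2-seg m] 1 N` (cf. `loop_eq_wideLadder`, which has one more bond).
[cite: Balaban1989LargeFieldI, p.196] -/
theorem loop_eq_wideLadder' {d : ℕ} (κ ν : Fin d) (m n₀ k : ℕ) :
    (seg ν (m : ℤ) ++ seg κ (n₀ : ℤ)) ++
        revWord (seg κ ((n₀ + k : ℕ) : ℤ) ++ seg ν (m : ℤ) ++ seg κ (-(k : ℤ))) =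
      wideLadder (seg ν (m : ℤ)) κ (n₀ + k) := by
  rw [wideLadder, revWord_append, revWord_append, revWord_seg, revWord_seg, revWord_seg, neg_neg]
  simp only [seg_natCast, List.replicate_add, List.append_assoc]

/-! ## §2 The rectangle `[y₁, b₁ − 1/2] × [y₂, x₂]` at `(x₃, …, x_d)`: flat, or moved to the face `x₃ = y₃` -/

/-- **The rectangle bound.**  For `x ∈ P₁ ∖ P₂` whose first coordinate lies in the range `[a′₁, b′₁]` of `P₂` (so that `x`
escapes `P₂` through another coordinate), the boundary of the full-width rectangle `(y₁, y₂, x₃, …) + [0, b₁ − y₁]e₁ + [0,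
x₂ − y₂]e₂` has holonomy within `5W²ε` of `1`: flat Stokes if the rectangle misses `P₂`, otherwise (`x₂ > b′₂`) moved in
direction `3` down to the face `x₃ = y₃` and spanned there. (Uses only the geometry, width, `U1` and plaquette parts of
`Case1Hyp`.) [cite: Balaban1989LargeFieldII, p.382] -/
theorem rect_bound (H : Case1Hyp lo hi lo' hi' τ' W V ε) {x : Site (n + 3)} (hx : x ∈ ann lo hi lo' hi')
    (h0 : lo' i0 ≤ x i0) (h0' : x i0 ≤ hi' i0) {m N : ℕ} (hm : x i1 - lo i1 = m) (hN : hi i0 - lo i0 = N) :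
    ‖((hol V (pt (lo i0) (lo i1) x) (wideLadder (seg i1 (m : ℤ)) i0 N) : 𝔸ˣ) : 𝔸) - 1‖ ≤ 5 * (W : ℝ) ^ 2 * ε := by
  have hxb := mem_box_iff.mp hx.1
  have hG := H.geom
  set w := wideLadder (seg i1 (m : ℤ)) i0 N with hw
  have hmW : m ≤ W := by have := H.natAbs_le hx.1 i1; rw [Pi.sub_apply, hm] at this; simpa using this
  have hNW : N ≤ W := by have := H.width i0; omega
  have hmhi : lo i1 + m ≤ hi i1 := by linarith [(hxb i1).2]
  have hNhi : lo i0 + (N : ℤ) ≤ hi i0 := by omega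
  have hW2 : (W : ℝ) ^ 2 * ε ≤ 5 * (W : ℝ) ^ 2 * ε := by nlinarith [H.eps_nonneg, sq_nonneg (W : ℝ)]
  by_cases hflat : (∃ κ : Fin (n + 3), 2 ≤ κ.val ∧ (x κ < lo' κ ∨ hi' κ < x κ)) ∨ x i1 < lo' i1
  · -- the rectangle avoids `P₂`: flat Stokes
    refine (flat_bound H hmhi hNhi (fun κ _ => hxb κ) (fun s t hs ht => ?_) hmW hNW).trans hW2
    rcases hflat with ⟨κ, hκ, hout⟩ | h1
    · rcases hout with hout | hout
      · exact not_mem_box_of_lt κ (by rwa [pt_high _ _ _ hκ])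
      · exact not_mem_box_of_gt κ (by rwa [pt_high _ _ _ hκ])
    · exact not_mem_box_of_lt i1 (by rw [pt_i1]; omega)
  · -- `P₂` meets the rectangle's plane region: then `x₂ > b′₂`; move down to the face `x₃ = y₃`
    simp only [not_or, not_exists, not_and, not_lt] at hflat
    obtain ⟨hin, h1⟩ := hflat
    have hin' : ∀ κ : Fin (n + 3), 2 ≤ κ.val → lo' κ ≤ x κ ∧ x κ ≤ hi' κ := fun κ hκ => hin κ hκ
    obtain ⟨hb0l, hb0r⟩ := hxb i0
    obtain ⟨hb1l, hb1r⟩ := hxb i1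
    obtain ⟨hb2l, hb2r⟩ := hxb i2
    have hx1 : hi' i1 < x i1 := by
      by_contra hle1
      exact hx.2 (mem_box_iff.mpr fun κ => by
        by_cases hκ : 2 ≤ κ.val
        · exact hin' κ hκ
        · rcases Nat.lt_succ_iff.mp (not_le.mp hκ) |>.eq_or_lt with e1 | e0
          · have : κ = i1 := Fin.ext e1
            subst this; exact ⟨h1, not_lt.mp hle1⟩
          · have : κ = i0 := Fin.ext (by rw [i0_val]; omega)
            subst this; exact ⟨h0, h0'⟩)
    -- `h = x₃ − y₃`; `x₀` = `x` moved to the face `x₃ = y₃`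
    obtain ⟨h, hh⟩ := Int.eq_ofNat_of_zero_le (show 0 ≤ x i2 - lo i2 by linarith)
    set x₀ : Site (n + 3) := x - (h : ℤ) • e i2 with hx₀
    have hx₀κ : ∀ κ : Fin (n + 3), x₀ κ = if κ = i2 then lo i2 else x κ := fun κ => by
      simp only [hx₀, Pi.sub_apply, zsmul_e_apply]
      split_ifs with h2
      · subst h2; omega
      · omega
    have hy₀ : ∀ κ : Fin (n + 3), 2 ≤ κ.val → lo κ ≤ x₀ κ ∧ x₀ κ ≤ hi κ := fun κ hκ => by
      rw [hx₀κ]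
      split_ifs with h2
      · subst h2; exact ⟨le_rfl, hb2l.trans hb2r⟩
      · exact hxb κ
    have hesc₀ : ∀ s t : ℕ, s ≤ N → t ≤ m → pt (lo i0 + s) (lo i1 + t) x₀ ∉ box lo' hi' :=
      fun s t _ _ => not_mem_box_of_lt i2 (by
        rw [pt_high _ _ _ (show 2 ≤ (i2 : Fin (n + 3)).val from le_rfl), hx₀κ, if_pos rfl]; exact hG.lo_lt i2)
    have hm₀ : x₀ i1 - lo i1 = m := by rw [hx₀κ, if_neg i2_ne_i1.symm]; exact hm
    have hflat0 := flat_bound H hmhi hNhi hy₀ hesc₀ hmW hNW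
    have hpx : pt (lo i0) (lo i1) x = pt (lo i0) (lo i1) x₀ + (h : ℤ) • e i2 := by
      rw [pt_add_e_high _ _ _ _ (show 2 ≤ (i2 : Fin (n + 3)).val from le_rfl), hx₀, sub_add_cancel]
    have hwdir : ∀ l ∈ w, l.1 ≠ i2 := fun l hl h2 => by
      rcases fst_eq_of_mem_wideLadder_seg hl with h' | h'
      · exact i2_ne_i1 (h2.symm.trans h')
      · exact i2_ne_i0 (h2.symm.trans h')
    have hwlen : w.length = 2 * (m + N) := by
      simp only [hw, wideLadder, List.length_append, length_seg, length_revWord, Int.natAbs_neg,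
        Int.natAbs_natCast]
      omega
    have hpaths : ∀ j : ℕ, j ≤ h → PathIn (ann lo hi lo' hi') (pt (lo i0) (lo i1) x₀ + (j : ℤ) • e i2) w := by
      intro j hj
      rw [pt_add_e_high _ _ _ _ (show 2 ≤ (i2 : Fin (n + 3)).val from le_rfl)]
      refine pathIn_wideLadder_seg fun s t hs ht hst => ?_
      rw [pt_add_e1, pt_add_e0]
      refine ⟨pt_mem_box_iff.mpr ⟨⟨by omega, by omega⟩, ⟨by omega, by omega⟩, fun κ hκ => ?_⟩, ?_⟩
      · simp only [Pi.add_apply, zsmul_e_apply, hx₀κ κ]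
        by_cases hκ2 : κ = i2
        · subst hκ2; rw [if_pos rfl, if_pos rfl]; constructor <;> omega
        · rw [if_neg hκ2, if_neg hκ2, add_zero]; exact hxb κ
      · rcases hst with rfl | rfl | rfl | rfl
        · exact not_mem_box_of_lt i1 (by rw [pt_i1]; have := hG.lo_lt i1; omega)
        · exact not_mem_box_of_gt i1 (by rw [pt_i1]; omega)
        · exact not_mem_box_of_lt i0 (by rw [pt_i0]; have := hG.lo_lt i0; omega)
        · exact not_mem_box_of_gt i0 (by rw [pt_i0]; have := hG.lt_hi i0; omega)
    have hshift := norm_hol_shift_sub_one_le H.unit H.plaq i2 w (disp_wideLadder _ _ _) hwdir h _ hpaths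
    rw [hpx]
    refine hshift.trans ?_
    rw [hwlen]
    have hhW : (h : ℝ) ≤ W := by
      have := H.natAbs_le hx.1 i2
      rw [Pi.sub_apply, hh, Int.natAbs_natCast] at this
      exact_mod_cast this
    have hmW' : (m : ℝ) ≤ W := by exact_mod_cast hmW
    have hNW' : (N : ℝ) ≤ W := by exact_mod_cast hNW
    have hε := H.eps_nonneg
    push_cast
    have hprod : (h : ℝ) * (2 * ((m : ℝ) + (N : ℝ)) * ε) ≤ W * (2 * ((W : ℝ) + W) * ε) :=
      mul_le_mul hhW (mul_le_mul_of_nonneg_right (by linarith) hε) (by positivity) (by positivity)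
    nlinarith [hprod, hflat0]

/-! ## §3 Re-thresholding: the contour of threshold `a` in the tree gauge of threshold `a′` -/

/-- The two tails after the common high part: usual `[2-seg (x₂−y₂)] ∪ [1-seg (x₁−y₁)]`, detour `[1-seg (b₁−½−y₁)] ∪
[2-seg (x₂−y₂)] ∪ [1-seg back]`, in the natural-number coordinates `m = x₂ − y₂`, `n₀ = x₁ − y₁`, `k = b₁ − 1/2 − x₁`.
[cite: Balaban1989LargeFieldI, p.196] -/
theorem contour_tails {x : Site (n + 3)} {m n₀ k : ℕ} (hm : x i1 - lo i1 = m) (hn₀ : x i0 - lo i0 = n₀)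
    (hk : hi i0 - x i0 = k) :
    treeWord (x - lo) = tw (highDirs n) (x - lo) ++ (seg i1 (m : ℤ) ++ seg i0 (n₀ : ℤ)) ∧
    tw (highDirs n) (x - lo) ++ detourTail lo hi x =
      tw (highDirs n) (x - lo) ++ (seg i0 ((n₀ + k : ℕ) : ℤ) ++ seg i1 (m : ℤ) ++ seg i0 (-(k : ℤ))) := by
  refine ⟨?_, ?_⟩
  · rw [treeWord_eq, List.append_assoc, Pi.sub_apply, Pi.sub_apply, hm, hn₀]
  · rw [detourTail, hm, show hi i0 - lo i0 = ((n₀ + k : ℕ) : ℤ) by push_cast; omega,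
      show x i0 - hi i0 = -(k : ℤ) by omega]

/-- **Re-thresholding, gauge form.**  In the tree gauge of an admissible threshold `a′` (`Case1Hyp … τ′ …`: `V(Γ^{a′}_{y,x})
= 1` on `P₁∖P₂`), the contour of ANY other admissible threshold `a` (`Geom … τ`) has `‖V(Γ^{a}_{y,x}) − 1‖ ≤ 5W²ε` for
every `x ∈ P₁ ∖ P₂`: the two contours coincide unless `x₁` lies between `a` and `a′`, and then `V(Γ^a_{y,x})` is conjugate
to the holonomy of the rectangle of `rect_bound` (or its inverse). [cite: Balaban1989LargeFieldI, p.196] -/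
theorem norm_hol_contour_rethreshold_le (H : Case1Hyp lo hi lo' hi' τ' W V ε) (hG : Geom lo hi lo' hi' τ)
    {x : Site (n + 3)} (hx : x ∈ ann lo hi lo' hi') :
    ‖((hol V lo (contour lo hi τ x) : 𝔸ˣ) : 𝔸) - 1‖ ≤ 5 * (W : ℝ) ^ 2 * ε := by
  have hxb := mem_box_iff.mp hx.1
  have hG' := H.geom
  have hnn : (0 : ℝ) ≤ 5 * (W : ℝ) ^ 2 * ε := by have := H.eps_nonneg; positivity
  -- the natural numbers m = x₂ − y₂, n₀ = x₁ − y₁, k = b₁ − 1/2 − x₁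
  obtain ⟨m, hm⟩ := Int.eq_ofNat_of_zero_le (show 0 ≤ x i1 - lo i1 by linarith [(hxb i1).1])
  obtain ⟨n₀, hn₀⟩ := Int.eq_ofNat_of_zero_le (show 0 ≤ x i0 - lo i0 by linarith [(hxb i0).1])
  obtain ⟨k, hk⟩ := Int.eq_ofNat_of_zero_le (show 0 ≤ hi i0 - x i0 by linarith [(hxb i0).2])
  have hN : hi i0 - lo i0 = ((n₀ + k : ℕ) : ℤ) := by push_cast; omega
  obtain ⟨hcu, hcd⟩ := contour_tails (lo := lo) (hi := hi) hm hn₀ hk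
  set c := tw (highDirs n) (x - lo) with hc
  set u := seg i1 (m : ℤ) ++ seg i0 (n₀ : ℤ) with hu
  set u' := seg i0 ((n₀ + k : ℕ) : ℤ) ++ seg i1 (m : ℤ) ++ seg i0 (-(k : ℤ)) with hu'
  have hp0 : lo + disp c = pt (lo i0) (lo i1) x := by rw [hc, disp_tw highDirs_nodup, add_restrict_highDirs]
  have hend : disp u' = disp u := by
    rw [hu, hu']
    simp only [disp_append, disp_seg]
    push_cast
    rw [add_zsmul, neg_zsmul]
    abel
  have hloop : u ++ revWord u' = wideLadder (seg i1 (m : ℤ)) i0 (n₀ + k) := by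
    rw [hu, hu']; exact loop_eq_wideLadder' i0 i1 m n₀ k
  clear_value c u u'
  -- the rectangle: `V_p(u) · V_p(u′)⁻¹ = V_p(wideLadder [2-seg m] 1 N)`
  have hrect : hol V (pt (lo i0) (lo i1) x) u * (hol V (pt (lo i0) (lo i1) x) u')⁻¹ =
      hol V (pt (lo i0) (lo i1) x) (wideLadder (seg i1 (m : ℤ)) i0 (n₀ + k)) := by
    rw [← hloop, hol_append, hol_revWord' V _ u' (by rw [hend])]
  have hcU : hol V lo c ∈ U1 𝔸 := hol_mem H.unit _ _
  by_cases hxτ : x i0 ≤ τ <;> by_cases hxτ' : x i0 ≤ τ'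
  · -- both usual: the same contour, `= 1` by the gauge
    rw [contour_of_le hxτ, ← contour_of_le (lo := lo) (hi := hi) hxτ', H.gauge x hx, Units.val_one, sub_self, norm_zero]
    exact hnn
  · -- `a′ < x₁ ≦ a`: usual for `a`, detour for `a′` (gauge-trivial)
    have hg := H.gauge x hx
    rw [contour_of_not_le hxτ', ← hc, hcd, hol_append, hp0] at hg
    have h0 : lo' i0 ≤ x i0 := by have := hG'.le_tau; omega
    have h0' : x i0 ≤ hi' i0 := hxτ.trans hG.tau_le
    have hid : hol V lo (contour lo hi τ x) = hol V lo c *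
        (hol V (pt (lo i0) (lo i1) x) u * (hol V (pt (lo i0) (lo i1) x) u')⁻¹) * (hol V lo c)⁻¹ := by
      rw [contour_of_le hxτ, hcu, hol_append, hp0, eq_inv_of_mul_eq_one_right hg]
      group
    rw [hid, hrect, Units.val_mul, Units.val_mul]
    exact (norm_units_conj_sub_one_le hcU _).trans (rect_bound H hx h0 h0' hm hN)
  · -- `a < x₁ ≦ a′`: detour for `a`, usual for `a′` (gauge-trivial)
    have hg := H.gauge x hx
    rw [contour_of_le hxτ', hcu, hol_append, hp0] at hg
    have h0 : lo' i0 ≤ x i0 := by have := hG.le_tau; omega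
    have h0' : x i0 ≤ hi' i0 := hxτ'.trans hG'.tau_le
    have hid : hol V lo (contour lo hi τ x) = hol V lo c *
        (hol V (pt (lo i0) (lo i1) x) u * (hol V (pt (lo i0) (lo i1) x) u')⁻¹)⁻¹ * (hol V lo c)⁻¹ := by
      rw [contour_of_not_le hxτ, ← hc, hcd, hol_append, hp0, eq_inv_of_mul_eq_one_right hg]
      group
    rw [hid, hrect, Units.val_mul, Units.val_mul]
    refine (norm_units_conj_sub_one_le hcU _).trans ?_
    exact (norm_inv_sub_one_le (hol_mem H.unit _ _)).trans (rect_bound H hx h0 h0' hm hN)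
  · -- both detour: the same contour
    rw [contour_of_not_le hxτ, ← contour_of_not_le (lo := lo) (hi := hi) hxτ', H.gauge x hx, Units.val_one, sub_self,
      norm_zero]
    exact hnn

/-- **Re-thresholding, ratio form** (gauge-free): for ANY `U1`-valued `U` whose plaquettes with corners in `P₁ ∖ P₂` are
`ε`-small and two admissible thresholds `a, a′` of the pair, `‖U(Γ^{a}_{y,x}) · U(Γ^{a′}_{y,x})⁻¹ − 1‖ ≤ 5W²ε` for every `x ∈
P₁ ∖ P₂` — the gauge functions `v(x) = U(Γ_{y,x})` of the two thresholds differ by a factor `5W²ε`-close to `1`.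
[cite: Balaban1989LargeFieldI, p.196] -/
theorem norm_hol_contour_ratio_le (hG : Geom lo hi lo' hi' τ) (hG' : Geom lo hi lo' hi' τ') (hW : ∀ κ, hi κ - lo κ ≤ W)
    {U : Site (n + 3) → Fin (n + 3) → 𝔸ˣ} (hU : ∀ x κ, U x κ ∈ U1 𝔸) (hε : 0 ≤ ε)
    (hP : PlaqSmallOn (ann lo hi lo' hi') U ε) {x : Site (n + 3)} (hx : x ∈ ann lo hi lo' hi') :
    ‖((hol U lo (contour lo hi τ x) * (hol U lo (contour lo hi τ' x))⁻¹ : 𝔸ˣ) : 𝔸) - 1‖ ≤ 5 * (W : ℝ) ^ 2 * ε := by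
  -- in the `a′`-gauge `U^{v′}`, `v′(z) = U(Γ^{a′}_{y,z})`: `U^{v′}(Γ^a_{y,x}) = v′(y) U(Γ^a_{y,x}) v′(x)⁻¹ = U(Γ^a)U(Γ^{a′})⁻¹`
  have H := case1Hyp_gaugeFixed (W := W) hG' hW hU hε hP
  have hid : hol (gaugeAct (treeGaugeFn U lo hi τ') U) lo (contour lo hi τ x) =
      hol U lo (contour lo hi τ x) * (hol U lo (contour lo hi τ' x))⁻¹ := by
    rw [hol_gaugeAct, disp_contour, add_sub_cancel, treeGaugeFn, treeGaugeFn, contour_self hG'.lo_le_tau, hol_nil,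
      one_mul]
  rw [← hid]
  exact norm_hol_contour_rethreshold_le H hG hx

end Literature.MathematicalPhysics.QuantumFieldTheory.Balaban1983to89.B16Ineq382
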